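import Literature.MathematicalPhysics.QuantumFieldTheory.Balaban1983to89.B9Thm310CommutatorSum
import Literature.MathematicalPhysics.QuantumFieldTheory.Balaban1983to89.B9Thm37CutoffGradTerms
import Literature.MathematicalPhysics.QuantumFieldTheory.Balaban1983to89.B9Thm37CutoffDivTerms
import Literature.MathematicalPhysics.QuantumFieldTheory.Balaban1983to89.B9Eq3105Coords
import Literature.MathematicalPhysics.QuantumFieldTheory.Balaban1983to89.Node00.OpsYBondLift

/-!
# `Balaban1983to89.B9Thm310CutoffDivTermsB` — T. Bałaban, *Propagators for lattice gauge theories in a background field*, Commun. Math. Phys. **99** (1985)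
# 389–434 [Balaban1985BackgroundPropagators], (3.100) p. 413 «similarly for adjoint derivatives» + Thm 3.3 (3.42)₃ pp. 397∕399: the RIGHT-ENTRY cube term
# `h_□G_□(U)h_□·∇*_{U,μ}` on the BOND sector — `‖h_□(b₋)(G_□(U)(h_□∇*_{U,μ}Λ))(b)‖ ≤ B₀(1 + m_N·e^{δ}·(5∕8)C1F∕M_h)·ℓ(y)·e^{−δd(y,y′)}|J|` — and its localized block
# majorant summed over the cover: the `hTF`∕`hKF` input of FILE 2-B `B9Thm310GTorusRegularEntries` at the cube cover of record (sub-row G-B9-LETTERS, M5.7 FILE 4b-B,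
# the bond twin of p21's `B9Thm37CutoffDivTerms`)

statement-level skeleton of published theorems with citation tags; proofs where landed; nothing here is a claim about the Yang–Mills mass gap

PDF held: `paper:balaban1985-cmp99-background-propagators` (journal page = PDF page + 388); pp. 392, 397, 399, 409, 413 read from the held text layer; [4] =
[Balaban1984PropagatorsII] (2.44) p. 230, (2.51)–(2.52) p. 232, p. 234.

THE PRINT.  p. 413 (3.100) and «similarly for adjoint derivatives»; (3.8) p. 392 `(D*_μA)(x) = R(U(x−ηe_μ,x))⁻¹A(x−ηe_μ) − A(x)`; p. 397 (3.42)₃ «|(G′(U)∇*_Uλ)(x)| ≦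
B₀Lʲηe^{−δ₀d(y,y′)}|λ|»; p. 399 Thm 3.3; p. 409 (3.87); [4] p. 232 «λ = Σ_{y′}Δ(y′)λ» (a majorant piece by piece), (2.44) p. 230 (the commutator terms are O(M⁻¹)).

WHY THIS FILE (cell context: G-B9-LETTERS M5.7; FILE 2-B ∕ 6-B display per direction `μ` and cube `□` the block majorant `hTF μ □` of
`(h_□·conj b G_□(U)·h_□)·conj b(D*_μ)` and the summed bound `hKF`; sibling of FILE 4a-B `B9Thm310CutoffGradTermsB`, the left-entry terms).  The cube term of the right
entry reads `Λ ↦ h_□·O(h_□·∇*_{U,μ}Λ)` for the cube letter `O = G_□(U)`.  p38's (3.100) for adjoint derivatives (`cdsB_cutMulY_apply`) gives the Leibniz rule along the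
backward bond `h(b₋)·(∇*_{U,μ}Λ)(b) = (∇*_{U,μ}(hΛ))(b) + c_f(h(b₋) − h(b₋−e_μ))·R(U_μ(b₋−e_μ))⁻¹Λ(⟨b₋−e_μ, ν⟩)` (`cutMulY_cdsB_eq`); the main term is (3.42)₃ for `O`
at `h_□Λ` (a member of the class, `h342₂`), the remainder `g` is split INPUT-SIDE into its block pieces over the carrier indices within `1` of `y′` ([4] (2.51)–(2.52);
`Λ(b″) ≠ 0` puts `Δ(b)` within one admissible bond of `Δ(βy′)`), each piece a member of the class of the profile `|c_f|κ₁·|J(·″)|·1_{Δ(βa)}` (`κ₁ = C1F∕(8S_j∕5)`,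
bi-contractive variables) and bounded by (3.42)₁ for `O`: `B₀ℓ(y)²e^{−δd(y,a)}·|c_f|κ₁|J| ≤ e^{δ}·B₀ℓ(y)·(κ₁L^{lev b})·e^{−δd(y,y′)}|J|` with `κ₁L^{lev b} ≤ (5∕8)C1F∕M_h`
because the OUTER factor `h_□(b₋) ≠ 0` forces `lev b ≤ j + 1` — print's «O(M⁻¹)»; `m_N` bounds the number of carrier indices within distance `1` of an index
(displayed `T`, `hT`, `hnbr` as in p21's file, and DISCHARGED here from [4] (2.61): `card_near_le_of_ineq261`, `m_N = e^{αδ}c₁(α)`).  §3 converts the bound into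
FILE 2-B's `hTF μ □` shape at `GACubeY` from the block `hE` (any ℝ-linear `D*` agreeing with `cdsB`) on FILE 3-B's localisation sets, and sums the overlap (`hKF μ`).

WHAT IS PROVED (all `theorem`s, 0 `def`, 0 sorry).  §1 `cutMulY_cdsB_eq` (the Leibniz rule along the backward bond), `card_near_le_of_ineq261`;
§2 ★★ `norm_hOh_cdsB_le` (the pointwise bound); §3 ★★ `hasMajorant_conj_divTermB` (the `hTF μ □` majorant at `GACubeY`, from `hE`), `sum_indicator_const_le`,
★★ `sum_divTermB_majorant_le` (the `hKF μ` bound, `A₂ = N′·M₂(Σ‖b_j‖)·B₀(1 + m_N e^{δ}(5∕8)C1F∕M_h)`).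
HONEST SCOPE.  Displayed: the cube letter's block `hE`, bi-contractivity `hU`, `η = |c_f|⁻¹`, the neighbourhood count `T`∕`hT`∕`hnbr` (or (2.61) via
`card_near_le_of_ineq261`), (2.61) for the overlap count.  The Laplacian cube term (`hTL`) and the transposed remainder (`hV`) are NOT treated (PLAN 4c∕5).  Nothing
continuum ∕ OS ∕ mass gap ∕ Clay; YM mass gap NOT proved by any of this (Track A conditional rung).  `--supports stmt-QuantumFields-19200`.  Net new unproved facts: 0.
-/

noncomputable section

namespace Literature.MathematicalPhysics.QuantumFieldTheory.Balaban1983to89.B9Thm310CutoffDivTermsB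

open Node00 B9CubeLettersInvReadings
open B9Thm37CubeCoverCommutators (cutMulY cutMulY_apply hTY)
open B9Thm37CubeCoverCommutatorSizes (side_conditions four_le_P' abs_hTY_shiftY_symm_sub_le)
open B9Thm37CubeCoverCommutatorSizesGrad (C1F_div_bigSide_eq)
open B9Thm37CommutatorBound389 (norm_cutMulY_le_of_le torusSupNorm_sub_shiftY_le_one dist_blkOf_le_one_of_touch)
open B9Thm37CutoffGradTerms (mem_QT_and_lev_of_near len_eq_pow_mul_eta torusSupNorm_sub_self_le_one)
open B9Eq3104CutoffCommutators (hBdY hBdY_apply cdsB_cutMulY_apply)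
open B9Thm310CommutatorBound389B (abs_le_supNorm_inr)
open B9Thm310CommutatorBound389BMajorant (hasMajorant_conj_of_ball_boundB norm_liftY_le_abs)
open B9Thm310CommutatorSum (sum_indicator_nearQT_le)
open B9CubeLettersInvReadDictB (h342₀_of_eBlockInvB h342₂_of_eBlockInvB)
open B9CubeLettersBondOpsL0 (GACubeY)
open B9Thm39CinvTorusRegular (conj_cutMulY)
open B9Thm37Sum (mulOp)
open Node00.OpsYBondLift (cdsBC cdsBC_apply)
open B6KLevelCensusIndexV1 (KIdx)
open B6Ineq2142KLevelV1 (β)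
open B6GlobalChartV1 (PV blkV1)
open B6Geom246MultiLevelBox (bset blkOf)
open B6Geom246MultiLevelTorus (bondT)
open B6Cover236MultiLevelBlocks (cubes)
open B6MultiLevelBoxOperator (bigSide)
open B6Partition118KLevelTorus (abs_hT_le_one)
open B6Partition118KLevelTorusCentral (QT blkOf_mem_QT_of_hT_ne_zero)
open B6Partition118KLevelFineSizes (C1F C1F_nonneg)
open B6RandomWalk (HasMajorant Ineq261 hasMajorant_mono)
open B9Thm34Ext (toB6)
open B9FromB6 (EBlock)
open B9GeoNormsKLevelV1 (geo9K geo9K_supNorm_nonneg)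
open B9GeoLemma21KLevelV1 (geo9K_dist_eq geo9K_dist_triangle geo9K_dist_comm)
open B9Ineq349SiteComposite (etaS_pos)
open B9Eq352DivFormLetters (conj)
open B9Eq39Adjoint (R)
open B9Eq310Hermitian (norm_R_le)
open Node00.OpsYNablaBridge (chartY shiftY_chartY shiftY_symm_chartY)
open B4TorusKernel.MultiPeriod (torusSupNorm)
open scoped Matrix

variable {𝔸 : Type} [NormedRing 𝔸] [NormedAlgebra ℂ 𝔸] [CompleteSpace 𝔸]
variable {d ℓ : ℕ} {hd : 1 ≤ d + 1} {hL : Odd (ℓ + 1) ∧ 1 < ℓ + 1} {b₀ b₁ : ℝ}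
variable {ι : Type} [Fintype ι]
variable (i : KIdx d ℓ hd hL b₀ b₁) (b : Module.Basis ι ℝ 𝔸)

/-! ## §1 The Leibniz rule along the backward bond; bi-contractivity; the neighbourhood count from (2.61) -/

section Leibniz

variable (U : CfgY 𝔸 i)

/-- **(3.100) ALONG THE BACKWARD BOND, REARRANGED**: `h(b₋)·(∇*_{U,μ}Λ)(b) = (∇*_{U,μ}(hΛ))(b) + c_f(h(b₋) − h(b₋−e_μ))·R(U_μ(b₋−e_μ))⁻¹Λ(⟨b₋−e_μ, ν⟩)`
(p38's `cdsB_cutMulY_apply`, solved for the cut-off on the outside). [cite: Balaban1985BackgroundPropagators, (3.100) p.413 («similarly for adjoint derivatives»), (3.8) p.392] -/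
theorem cutMulY_cdsB_eq (μ : Fin (d + 1)) (h : SiteY i → ℝ) (Λ : FBondY i → 𝔸) (w : FBondY i) :
    cutMulY (hBdY i h) (cdsB i U μ Λ) w = cdsB i U μ (cutMulY (hBdY i h) Λ) w
      + ((i.cf * (h (chartY i w.src) - h (chartY i (w.src.unshift μ))) : ℝ) : ℂ) • R (U μ (w.src.unshift μ))⁻¹ (Λ ⟨w.src.unshift μ, w.dir⟩) := by
  rw [cdsB_cutMulY_apply, cutMulY_apply, hBdY_apply, add_assoc, ← add_smul]
  have e : ((i.cf * (h (chartY i (w.src.unshift μ)) - h (chartY i w.src)) : ℝ) : ℂ)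
      + ((i.cf * (h (chartY i w.src) - h (chartY i (w.src.unshift μ))) : ℝ) : ℂ) = 0 := by
    rw [← Complex.ofReal_add]; push_cast; ring
  rw [e, zero_smul, add_zero]

end Leibniz

section Count

variable [Fintype (geo9K i).Site] {Rr : ℝ} {Hp : Prop}

/-- **THE NEIGHBOURHOOD COUNT `m_N` FROM (2.61)**: the number of carrier indices within distance `1` of an index is at most `e^{αδ}·c₁(α)` (`αδ ≥ 0`) — discharging the
displayed `hnbr` of §2 with `T y′ = {a : d(a,y′) ≤ 1}`. [cite: Balaban1984PropagatorsII, Lemma 2.1 (2.61) p.234, (2.46) p.231] -/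
theorem card_near_le_of_ineq261 (d' : ℕ) {δ α : ℝ} (hαδ : 0 ≤ α * δ) (h261 : Ineq261 d' (toB6 (geo9K i) Rr Hp) δ α) (y' : (geo9K i).Site) :
    (((Finset.univ.filter fun a : (geo9K i).Site => (geo9K i).dist a y' ≤ 1).card : ℕ) : ℝ) ≤ Real.exp (α * δ) * B6.c1 d' δ α := by
  classical
  have hrow : (∑ a : (geo9K i).Site, Real.exp (-(α * δ * (geo9K i).dist y' a))) ≤ B6.c1 d' δ α := h261 y'
  have h1 : ∀ a : (geo9K i).Site, (if (geo9K i).dist a y' ≤ 1 then (1 : ℝ) else 0) ≤ Real.exp (α * δ) * Real.exp (-(α * δ * (geo9K i).dist y' a)) := by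
    intro a
    by_cases h : (geo9K i).dist a y' ≤ 1
    · rw [if_pos h, ← Real.exp_add, geo9K_dist_comm i y' a]
      exact Real.one_le_exp (by nlinarith)
    · rw [if_neg h]; positivity
  calc (((Finset.univ.filter fun a : (geo9K i).Site => (geo9K i).dist a y' ≤ 1).card : ℕ) : ℝ)
      = ∑ a : (geo9K i).Site, (if (geo9K i).dist a y' ≤ 1 then (1 : ℝ) else 0) := by
        rw [Finset.card_filter]; push_cast; rfl
    _ ≤ ∑ a : (geo9K i).Site, Real.exp (α * δ) * Real.exp (-(α * δ * (geo9K i).dist y' a)) := Finset.sum_le_sum fun a _ => h1 a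
    _ = Real.exp (α * δ) * ∑ a : (geo9K i).Site, Real.exp (-(α * δ * (geo9K i).dist y' a)) := by rw [Finset.mul_sum]
    _ ≤ Real.exp (α * δ) * B6.c1 d' δ α := mul_le_mul_of_nonneg_left hrow (Real.exp_nonneg _)

end Count

/-! ## §2 The right-entry cube term, pointwise: `h_□·O(h_□∇*_{U,μ}Λ)`, «with (Lʲη)² replaced by Lʲη» -/

section Div

variable (U : CfgY 𝔸 i) (O : (FBondY i → 𝔸) →ₗ[ℂ] (FBondY i → 𝔸)) {B₀ δ : ℝ}

/-- ★★ **THE RIGHT-ENTRY TERM OF A LOCALIZED CUBE PROPAGATOR, BOND SECTOR**: for a bond cube letter `O` with its (3.42) entries over the class DISPLAYED (`h342₀`: first member;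
`h342₂`: third member), a corner-free member with `η = |c_f|⁻¹`, bi-contractive bond variables, and a neighbourhood count `m_N` of the carrier indices within distance `1`
of any index (`T`, `hT`, `hnbr`): `‖h_□(b₋)·O(h_□∇*_{U,μ}Λ)(b)‖ ≤ B₀(1 + m_N·e^{δ}·(5∕8)C1F∕M_h)·ℓ(y)·e^{−δd(y,y′)}·|J|` for `b ∈ Δ(βy)`, `‖Λ‖ ≤ |J|`, `supp J ⊂ Δ(βy′)` —
(3.100) along the backward bond; the main term `O∇*_{U,μ}(h_□Λ)` by (3.42)₃; the remainder `c_f(∂⁻_μh_□)·R(U)⁻¹Λ(·″)` split into its block pieces over the indices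
within `1` of `y′` ([4] (2.51)–(2.52)), each bounded by (3.42)₁ at the cost `|c_f||∂h_□|·B₀ℓ(y)² ≤ (5∕8)(C1F∕M_h)·B₀ℓ(y)` because `|c_f|ℓ(y) = L^{lev b} ≤ L^{j+1}` on
`supp h_□` («O(M⁻¹)», [4] (2.44)), and `e^{−δd(y,a)} ≤ e^{δ}e^{−δd(y,y′)}` for `d(a,y′) ≤ 1`.
[cite: Balaban1985BackgroundPropagators, (3.100) p.413, (3.8) p.392, Thm 3.3 p.399 with (3.42) p.397 (first and third members), (3.87) p.409; Balaban1984PropagatorsII, (2.44) p.230, (2.51)–(2.52) p.232, p.234] -/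
theorem norm_hOh_cdsB_le (c : ↥(cubes i.D.toDomains)) (hB₀ : 0 ≤ B₀) (hδ : 0 ≤ δ) (hη : etaS i = |i.cf|⁻¹)
    (ιB : BlkY i → IBondY i) (hι : ∀ s, β i.hN i.D i.hk (ιB s) = s)
    (hU : ∀ μ x, ‖(U μ x : 𝔸)‖ ≤ 1 ∧ ‖(((U μ x)⁻¹ : 𝔸ˣ) : 𝔸)‖ ≤ 1)
    (h342₀ : ∀ (J : FBondY i → ℝ) (y y' : IBondY i), (geo9K i).suppIn (Sum.inr J) y' →
      ∀ Λ : FBondY i → 𝔸, (∀ x, ‖Λ x‖ ≤ |J x|) → ∀ x : FBondY i, blkV1 i.hN i.D x = β i.hN i.D i.hk y →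
        ‖O Λ x‖ ≤ B₀ * (geo9K i).len y ^ 2 * Real.exp (-(δ * (geo9K i).dist y y')) * (geo9K i).supNorm (Sum.inr J))
    (h342₂ : ∀ (J : FBondY i → ℝ) (y y' : IBondY i), (geo9K i).suppIn (Sum.inr J) y' →
      ∀ Λ : FBondY i → 𝔸, (∀ x, ‖Λ x‖ ≤ |J x|) → ∀ (x : FBondY i) (ν : Fin (d + 1)), blkV1 i.hN i.D x = β i.hN i.D i.hk y →
        ‖O (cdsB i U ν Λ) x‖ ≤ B₀ * (geo9K i).len y * Real.exp (-(δ * (geo9K i).dist y y')) * (geo9K i).supNorm (Sum.inr J))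
    (T : IBondY i → Finset (IBondY i)) (hT : ∀ a y' : IBondY i, (geo9K i).dist a y' ≤ 1 → a ∈ T y')
    {mN : ℝ} (hmN : 0 ≤ mN) (hnbr : ∀ y' : IBondY i, ((T y').card : ℝ) ≤ mN)
    (J : FBondY i → ℝ) (y y' : IBondY i) (hs : (geo9K i).suppIn (Sum.inr J) y')
    (Λ : FBondY i → 𝔸) (hΛ : ∀ x, ‖Λ x‖ ≤ |J x|) (x : FBondY i) (μ : Fin (d + 1)) (hx : blkV1 i.hN i.D x = β i.hN i.D i.hk y) :
    ‖cutMulY (hBdY i (hTY i c)) (O (cutMulY (hBdY i (hTY i c)) (cdsB i U μ Λ))) x‖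
      ≤ B₀ * (1 + mN * Real.exp δ * (5 / 8 * C1F d ℓ / i.Mh)) * (geo9K i).len y * Real.exp (-(δ * (geo9K i).dist y y'))
          * (geo9K i).supNorm (Sum.inr J) := by
  classical
  obtain ⟨_, hMh2, _, _⟩ := side_conditions i
  have hη0 : 0 < etaS i := etaS_pos i
  have hcf0 : 0 < |i.cf| := by
    have h := hη0; rw [hη] at h; exact inv_pos.1 h
  have hL1 : (1 : ℝ) ≤ (ℓ : ℝ) + 1 := by linarith [(Nat.cast_nonneg ℓ : (0 : ℝ) ≤ ℓ)]
  have hM : (0 : ℝ) < i.Mh := by exact_mod_cast (lt_of_lt_of_le (by norm_num) hMh2)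
  have hE0 : 0 ≤ Real.exp (-(δ * (geo9K i).dist y y')) := (Real.exp_pos _).le
  have hF0 : 0 ≤ (geo9K i).supNorm (Sum.inr J) := geo9K_supNorm_nonneg i _
  have hleny : 0 ≤ (geo9K i).len y := (B6KLevelCensusIndexV1.len_pos i y).le
  have hC : 0 ≤ C1F d ℓ := C1F_nonneg d ℓ
  have hRHS : 0 ≤ B₀ * (1 + mN * Real.exp δ * (5 / 8 * C1F d ℓ / i.Mh)) * (geo9K i).len y * Real.exp (-(δ * (geo9K i).dist y y'))
      * (geo9K i).supNorm (Sum.inr J) := by positivity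
  set h : SiteY i → ℝ := hTY i c with hh
  set z : SiteY i := chartY i x.src with hzdef
  have hxz : blkOf i.D.toDomains z = β i.hN i.D i.hk y := hx
  -- output localisation: the term carries the factor `h_□(b₋)`
  by_cases hz0 : h z = 0
  · rw [cutMulY_apply, hBdY_apply, ← hzdef, hz0, Complex.ofReal_zero, zero_smul, norm_zero]; exact hRHS
  have hnear : levY i z ≤ c.1.1 + 1 := (mem_QT_and_lev_of_near i c (z := z) (u' := z) hz0 (torusSupNorm_sub_self_le_one i z)).2
  have hh1 : ∀ w : FBondY i, |hBdY i h w| ≤ 1 := fun w => abs_hT_le_one i.D (B9GeoLemma21KLevelV1.one_le_Mh i) (B9GeoLemma21KLevelV1.one_le_P i) c _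
  have hΛ' : ∀ w, ‖cutMulY (𝔸 := 𝔸) (hBdY i h) Λ w‖ ≤ |J w| := norm_cutMulY_le_of_le hh1 hΛ
  -- the bond coefficient `κ₁ ≥ |∂h_□|` and its level-uniform form `κ₁·L^{lev z} ≤ (5/8)·C1F/M_h`
  set κ₁ : ℝ := C1F d ℓ / (8 / 5 * (bigSide ℓ i.Mh c.1.1 : ℝ)) with hκ₁
  have hκ0 : 0 ≤ κ₁ := le_trans (abs_nonneg _) (abs_hTY_shiftY_symm_sub_le i c μ z)
  have hlen : (geo9K i).len y = ((ℓ : ℝ) + 1) ^ levY i z * etaS i := len_eq_pow_mul_eta i hη hxz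
  have hκpow : κ₁ * ((ℓ : ℝ) + 1) ^ levY i z ≤ 5 / 8 * C1F d ℓ / i.Mh := by
    rw [hκ₁, C1F_div_bigSide_eq i c.1.1]
    have hLj : (0 : ℝ) < ((ℓ : ℝ) + 1) ^ c.1.1 := pow_pos (by linarith) _
    have hq : (((ℓ : ℝ) + 1) ^ c.1.1)⁻¹ * ((ℓ : ℝ) + 1) ^ levY i z ≤ (ℓ : ℝ) + 1 := by
      rw [inv_mul_le_iff₀ hLj]
      calc ((ℓ : ℝ) + 1) ^ levY i z ≤ ((ℓ : ℝ) + 1) ^ (c.1.1 + 1) := pow_le_pow_right₀ hL1 hnear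
        _ = ((ℓ : ℝ) + 1) ^ c.1.1 * ((ℓ : ℝ) + 1) := pow_succ _ _
    calc 5 / 8 * C1F d ℓ / (((ℓ : ℝ) + 1) * i.Mh) * (((ℓ : ℝ) + 1) ^ c.1.1)⁻¹ * ((ℓ : ℝ) + 1) ^ levY i z
        = 5 / 8 * C1F d ℓ / (((ℓ : ℝ) + 1) * i.Mh) * ((((ℓ : ℝ) + 1) ^ c.1.1)⁻¹ * ((ℓ : ℝ) + 1) ^ levY i z) := by ring
      _ ≤ 5 / 8 * C1F d ℓ / (((ℓ : ℝ) + 1) * i.Mh) * ((ℓ : ℝ) + 1) := mul_le_mul_of_nonneg_left hq (by positivity)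
      _ = 5 / 8 * C1F d ℓ / i.Mh := by field_simp
  -- `|c_f|·ℓ(y)² = L^{lev z}·ℓ(y)` (η = |c_f|⁻¹)
  have hcfl : |i.cf| * (geo9K i).len y ^ 2 = ((ℓ : ℝ) + 1) ^ levY i z * (geo9K i).len y := by
    rw [hlen, hη]; field_simp
  -- the remainder of the Leibniz rule, its block pieces and their profiles
  set g : FBondY i → 𝔸 := fun w =>
    ((i.cf * (h (chartY i w.src) - h (chartY i (w.src.unshift μ))) : ℝ) : ℂ) • R (U μ (w.src.unshift μ))⁻¹ (Λ ⟨w.src.unshift μ, w.dir⟩) with hg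
  set gp : IBondY i → FBondY i → 𝔸 := fun a w => if ιB (blkV1 i.hN i.D w) = a then g w else 0 with hgp
  set fp : IBondY i → FBondY i → ℝ := fun a w => if ιB (blkV1 i.hN i.D w) = a then |i.cf| * κ₁ * |J ⟨w.src.unshift μ, w.dir⟩| else 0 with hfp
  -- (i) the size of the remainder: `‖g(w)‖ ≤ |c_f|κ₁·|J(w″)|`
  have hgle : ∀ w : FBondY i, ‖g w‖ ≤ |i.cf| * κ₁ * |J ⟨w.src.unshift μ, w.dir⟩| := fun w => by
    have hκ := abs_hTY_shiftY_symm_sub_le i c μ (chartY i w.src)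
    rw [shiftY_symm_chartY] at hκ
    have hRi : ‖R (U μ (w.src.unshift μ))⁻¹ (Λ ⟨w.src.unshift μ, w.dir⟩)‖ ≤ ‖Λ ⟨w.src.unshift μ, w.dir⟩‖ :=
      norm_R_le (hU μ _).2 (by rw [inv_inv]; exact (hU μ _).1) _
    show ‖((i.cf * (h (chartY i w.src) - h (chartY i (w.src.unshift μ))) : ℝ) : ℂ) • R (U μ (w.src.unshift μ))⁻¹ (Λ ⟨w.src.unshift μ, w.dir⟩)‖ ≤ _
    rw [norm_smul, Complex.norm_real, Real.norm_eq_abs, abs_mul, abs_sub_comm]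
    exact mul_le_mul (mul_le_mul_of_nonneg_left hκ (abs_nonneg _)) (hRi.trans (hΛ _)) (norm_nonneg _) (mul_nonneg (abs_nonneg _) hκ0)
  -- (ii) where the remainder is non-zero the block is within `1` of `βy′`
  have hdist1 : ∀ w : FBondY i, g w ≠ 0 → (geo9K i).dist (ιB (blkV1 i.hN i.D w)) y' ≤ 1 := fun w hw => by
    have hJ : J ⟨w.src.unshift μ, w.dir⟩ ≠ 0 := fun h0 =>
      hw (norm_le_zero_iff.1 ((hgle w).trans (by rw [h0, abs_zero, mul_zero])))
    have hblk : blkV1 i.hN i.D ⟨w.src.unshift μ, w.dir⟩ = β i.hN i.D i.hk y' := hs _ hJ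
    have hblk' : blkOf i.D.toDomains ((shiftY i μ).symm (chartY i w.src)) = β i.hN i.D i.hk y' := by
      rw [shiftY_symm_chartY]; exact hblk
    rw [geo9K_dist_eq, hι, ← hblk']
    exact_mod_cast dist_blkOf_le_one_of_touch i (torusSupNorm_sub_shiftY_le_one i μ (chartY i w.src)).2
  have hmemT : ∀ w : FBondY i, g w ≠ 0 → ιB (blkV1 i.hN i.D w) ∈ T y' := fun w hw => hT _ _ (hdist1 w hw)
  -- (iii) the remainder is the sum of its pieces over `T y′`
  have hsplit : g = ∑ a ∈ T y', gp a := by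
    funext w
    rw [Finset.sum_apply]
    show g w = ∑ a ∈ T y', (if ιB (blkV1 i.hN i.D w) = a then g w else 0)
    by_cases hw : g w = 0
    · rw [hw]; symm
      exact Finset.sum_eq_zero fun a _ => ite_self 0
    · rw [Finset.sum_ite_eq, if_pos (hmemT w hw)]
  -- (iv) the Leibniz split under `O`
  have hfun : cutMulY (hBdY i h) (cdsB i U μ Λ) = cdsB i U μ (cutMulY (hBdY i h) Λ) + g := by
    funext w; rw [Pi.add_apply]; exact cutMulY_cdsB_eq i U μ h Λ w
  have hO : O (cutMulY (hBdY i h) (cdsB i U μ Λ)) x = O (cdsB i U μ (cutMulY (hBdY i h) Λ)) x + ∑ a ∈ T y', O (gp a) x := by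
    rw [hfun, map_add, Pi.add_apply, hsplit, map_sum, Finset.sum_apply]
  -- (v) each piece: (3.42)₁ for `O` at the block `a`, the profile `|c_f|κ₁|J(·″)|1_{Δ(βa)}`; far pieces vanish
  have hpiece : ∀ a ∈ T y', ‖O (gp a) x‖
      ≤ B₀ * (geo9K i).len y ^ 2 * (Real.exp δ * Real.exp (-(δ * (geo9K i).dist y y'))) * (|i.cf| * κ₁ * (geo9K i).supNorm (Sum.inr J)) := by
    intro a _
    by_cases ha : (geo9K i).dist a y' ≤ 1
    · have hcls : ∀ w, ‖gp a w‖ ≤ |fp a w| := fun w => by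
        show ‖(if ιB (blkV1 i.hN i.D w) = a then g w else 0)‖
          ≤ |(if ιB (blkV1 i.hN i.D w) = a then |i.cf| * κ₁ * |J ⟨w.src.unshift μ, w.dir⟩| else 0)|
        split_ifs
        · exact (hgle w).trans (le_abs_self _)
        · rw [norm_zero, abs_zero]
      have hsa : (geo9K i).suppIn (Sum.inr (fp a)) a := by
        intro w hw
        have hwa : ιB (blkV1 i.hN i.D w) = a := by
          by_contra hne
          exact hw (show (if ιB (blkV1 i.hN i.D w) = a then |i.cf| * κ₁ * |J ⟨w.src.unshift μ, w.dir⟩| else 0) = 0 by rw [if_neg hne])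
        show blkV1 i.hN i.D w = β i.hN i.D i.hk a
        rw [← hwa, hι]
      have hsup : (geo9K i).supNorm (Sum.inr (fp a)) ≤ |i.cf| * κ₁ * (geo9K i).supNorm (Sum.inr J) := by
        refine Real.iSup_le (fun w => ?_) (mul_nonneg (mul_nonneg (abs_nonneg _) hκ0) hF0)
        show |(if ιB (blkV1 i.hN i.D w) = a then |i.cf| * κ₁ * |J ⟨w.src.unshift μ, w.dir⟩| else 0)| ≤ _
        split_ifs
        · rw [abs_of_nonneg (mul_nonneg (mul_nonneg (abs_nonneg _) hκ0) (abs_nonneg _))]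
          exact mul_le_mul_of_nonneg_left (abs_le_supNorm_inr i J _) (mul_nonneg (abs_nonneg _) hκ0)
        · rw [abs_zero]; exact mul_nonneg (mul_nonneg (abs_nonneg _) hκ0) hF0
      have h1 := h342₀ (fp a) y a hsa (gp a) hcls x hx
      have hexp : Real.exp (-(δ * (geo9K i).dist y a)) ≤ Real.exp δ * Real.exp (-(δ * (geo9K i).dist y y')) := by
        rw [← Real.exp_add]
        refine Real.exp_le_exp.2 ?_
        have htri := geo9K_dist_triangle i y a y'
        have h2 : δ * (geo9K i).dist y y' ≤ δ * ((geo9K i).dist y a + 1) :=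
          mul_le_mul_of_nonneg_left (htri.trans (by linarith)) hδ
        linarith
      have hX : 0 ≤ B₀ * (geo9K i).len y ^ 2 := by positivity
      calc ‖O (gp a) x‖ ≤ _ := h1
        _ ≤ _ := mul_le_mul (mul_le_mul_of_nonneg_left hexp hX) hsup (geo9K_supNorm_nonneg i _) (by positivity)
    · have h0 : gp a = 0 := by
        funext w
        show (if ιB (blkV1 i.hN i.D w) = a then g w else 0) = 0
        split_ifs with hwa
        · by_contra hne
          have h1 := hdist1 w hne
          rw [hwa] at h1
          exact ha h1
        · rfl
      rw [h0, map_zero, Pi.zero_apply, norm_zero]; positivity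
  -- (vi) the remainder summed: at most `m_N` pieces
  have hrem : ‖∑ a ∈ T y', O (gp a) x‖
      ≤ mN * (B₀ * (geo9K i).len y ^ 2 * (Real.exp δ * Real.exp (-(δ * (geo9K i).dist y y'))) * (|i.cf| * κ₁ * (geo9K i).supNorm (Sum.inr J))) := by
    have hP0 : 0 ≤ B₀ * (geo9K i).len y ^ 2 * (Real.exp δ * Real.exp (-(δ * (geo9K i).dist y y'))) * (|i.cf| * κ₁ * (geo9K i).supNorm (Sum.inr J)) := by
      positivity
    calc ‖∑ a ∈ T y', O (gp a) x‖ ≤ ∑ a ∈ T y', ‖O (gp a) x‖ := norm_sum_le _ _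
      _ ≤ ∑ a ∈ T y', B₀ * (geo9K i).len y ^ 2 * (Real.exp δ * Real.exp (-(δ * (geo9K i).dist y y'))) * (|i.cf| * κ₁ * (geo9K i).supNorm (Sum.inr J)) :=
          Finset.sum_le_sum hpiece
      _ = ((T y').card : ℝ) * (B₀ * (geo9K i).len y ^ 2 * (Real.exp δ * Real.exp (-(δ * (geo9K i).dist y y'))) *
          (|i.cf| * κ₁ * (geo9K i).supNorm (Sum.inr J))) := by rw [Finset.sum_const, nsmul_eq_mul]
      _ ≤ _ := mul_le_mul_of_nonneg_right (hnbr y') hP0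
  -- (vii) assemble: the outer factor `|h_□(b₋)| ≤ 1`, the main term by (3.42)₃ at `h_□Λ`, the remainder
  have hA : ‖O (cdsB i U μ (cutMulY (hBdY i h) Λ)) x‖ ≤ B₀ * (geo9K i).len y * Real.exp (-(δ * (geo9K i).dist y y')) * (geo9K i).supNorm (Sum.inr J) :=
    h342₂ J y y' hs (cutMulY (hBdY i h) Λ) hΛ' x μ hx
  rw [cutMulY_apply, norm_smul, Complex.norm_real, Real.norm_eq_abs, hO]
  calc |hBdY i h x| * ‖O (cdsB i U μ (cutMulY (hBdY i h) Λ)) x + ∑ a ∈ T y', O (gp a) x‖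
      ≤ 1 * (‖O (cdsB i U μ (cutMulY (hBdY i h) Λ)) x‖ + ‖∑ a ∈ T y', O (gp a) x‖) :=
        mul_le_mul (hh1 x) (norm_add_le _ _) (norm_nonneg _) zero_le_one
    _ ≤ B₀ * (geo9K i).len y * Real.exp (-(δ * (geo9K i).dist y y')) * (geo9K i).supNorm (Sum.inr J)
          + mN * (B₀ * (geo9K i).len y ^ 2 * (Real.exp δ * Real.exp (-(δ * (geo9K i).dist y y')))
              * (|i.cf| * κ₁ * (geo9K i).supNorm (Sum.inr J))) := by rw [one_mul]; exact add_le_add hA hrem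
    _ = B₀ * (1 + mN * Real.exp δ * (κ₁ * ((ℓ : ℝ) + 1) ^ levY i z)) * (geo9K i).len y
          * Real.exp (-(δ * (geo9K i).dist y y')) * (geo9K i).supNorm (Sum.inr J) := by
        have e : mN * (B₀ * (geo9K i).len y ^ 2 * (Real.exp δ * Real.exp (-(δ * (geo9K i).dist y y'))) * (|i.cf| * κ₁ * (geo9K i).supNorm (Sum.inr J)))
            = mN * Real.exp δ * κ₁ * B₀ * (|i.cf| * (geo9K i).len y ^ 2) * Real.exp (-(δ * (geo9K i).dist y y')) * (geo9K i).supNorm (Sum.inr J) := by ring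
        rw [e, hcfl]; ring
    _ ≤ B₀ * (1 + mN * Real.exp δ * (5 / 8 * C1F d ℓ / i.Mh)) * (geo9K i).len y
          * Real.exp (-(δ * (geo9K i).dist y y')) * (geo9K i).supNorm (Sum.inr J) := by
        refine mul_le_mul_of_nonneg_right (mul_le_mul_of_nonneg_right (mul_le_mul_of_nonneg_right ?_ hleny) hE0) hF0
        refine mul_le_mul_of_nonneg_left ?_ hB₀
        have h4 : 0 ≤ mN * Real.exp δ := by positivity
        have h5 := mul_le_mul_of_nonneg_left hκpow h4
        linarith

end Div

/-! ## §3 The block majorant of the conjugated right-entry term (FILE 2-B's `hTF μ □` at `GACubeY`) and its sum over the cover (`hKF μ`) -/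

section Majorant

variable [Fintype (geo9K i).Site] {Rr : ℝ} {Hp : Prop}
variable (ιB : BlkY i → IBondY i)
variable {B : B9.Backgrounds} (cfg : B.Cfg → CfgY 𝔸 i) (par : BondParY 𝔸 i) {U₁ : B.Cfg}

/-- ★★ **THE `hTF μ □` INPUT OF FILE 2-B AT THE CUBE LETTER `G_□(U) = GACubeY`, FROM ITS (3.42) BLOCK OVER THE CLASS**: for any ℝ-linear `D*` agreeing pointwise with
`∇*_{U,μ}` at `U = cfg U₁` and a neighbourhood count `m_N` (`T`, `hT`, `hnbr`), `(h_□·conj b G_□(U)·h_□)·conj b(D*)` has the localized block majorant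
`1_{S′_□}(a)·M₂(Σ‖b_j‖)·B₀(1 + m_N e^{δ}(5∕8)C1F∕M_h)·ℓ(a)·e^{−δd(a,a′)}` on FILE 3-B's sets `S′_□ = {a : ∃ y ∈ QT □, d_T(βa, y) ≤ 2L+4}` (the term carries the outer
`h_□(b₋)`, so `Δ(b) ∈ QT □`). [cite: Balaban1985BackgroundPropagators, (3.100) p.413, Thm 3.3 (3.42)₃ pp.397–399, (3.87) p.409; Balaban1984PropagatorsII, (2.51)–(2.52) p.232] -/
theorem hasMajorant_conj_divTermB (hι : ∀ s, β i.hN i.D i.hk (ιB s) = s)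
    {M₂ : ℝ} (hM₂ : 0 ≤ M₂) (hrepr : ∀ (v : 𝔸) (j : ι), |b.repr v j| ≤ M₂ * ‖v‖) (hη : etaS i = |i.cf|⁻¹)
    (parS : SiteParY 𝔸 i) (parB : BondParY 𝔸 i) {B₀ δ : ℝ} (hB₀ : 0 ≤ B₀) (hδ : 0 ≤ δ)
    (c : ↥(cubes i.D.toDomains)) (hE : EBlock (kernelFamilyBInv i B cfg (GACubeY i c parS parB) par) B₀ δ U₁)
    (hU : ∀ μ x, ‖(cfg U₁ μ x : 𝔸)‖ ≤ 1 ∧ ‖(((cfg U₁ μ x)⁻¹ : 𝔸ˣ) : 𝔸)‖ ≤ 1)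
    (T : IBondY i → Finset (IBondY i)) (hT : ∀ a y' : IBondY i, (geo9K i).dist a y' ≤ 1 → a ∈ T y')
    {mN : ℝ} (hmN : 0 ≤ mN) (hnbr : ∀ y' : IBondY i, ((T y').card : ℝ) ≤ mN)
    (μ : Fin (d + 1)) (Ds : Module.End ℝ (FBondY i → 𝔸)) (hDs : ∀ Λ, Ds Λ = cdsB i (cfg U₁) μ Λ) :
    HasMajorant (g := toB6 (geo9K i) Rr Hp) (fun p : FBondY i × ι => ιB (blkV1 i.hN i.D p.1))
      ((mulOp (fun p : FBondY i × ι => hBdY i (hTY i c) p.1) * conj b ((GACubeY i c parS parB (cfg U₁)).restrictScalars ℝ) *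
        mulOp (fun p : FBondY i × ι => hBdY i (hTY i c) p.1)) * conj b Ds)
      (fun a a' => if (∃ y ∈ QT i.D (B9GeoLemma21KLevelV1.one_le_Mh i) (four_le_P' i) c,
          (((bondT i.D).dist (β i.hN i.D i.hk a) y : ℕ) : ℝ) ≤ 2 * (ℓ : ℝ) + 6)
        then M₂ * (∑ j, ‖b j‖) * (B₀ * (1 + mN * Real.exp δ * (5 / 8 * C1F d ℓ / i.Mh))) * (geo9K i).len a
          * Real.exp (-(δ * (geo9K i).dist a a')) else 0) := by
  classical
  obtain ⟨_, hMh2, hR2, _⟩ := side_conditions i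
  -- the operator as ONE conjugated ℝ-linear letter
  set Rl : Module.End ℝ (FBondY i → 𝔸) := ((cutMulY (𝔸 := 𝔸) (hBdY i (hTY i c))).restrictScalars ℝ *
    (GACubeY i c parS parB (cfg U₁)).restrictScalars ℝ * (cutMulY (𝔸 := 𝔸) (hBdY i (hTY i c))).restrictScalars ℝ) * Ds with hRl
  have hRl_apply : ∀ Λ, Rl Λ = cutMulY (hBdY i (hTY i c)) (GACubeY i c parS parB (cfg U₁) (cutMulY (hBdY i (hTY i c)) (cdsB i (cfg U₁) μ Λ))) :=
    fun Λ => by simp only [hRl, Module.End.mul_apply, LinearMap.restrictScalars_apply, hDs]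
  have hconj : conj b Rl = (mulOp (fun p : FBondY i × ι => hBdY i (hTY i c) p.1) *
      conj b ((GACubeY i c parS parB (cfg U₁)).restrictScalars ℝ) * mulOp (fun p : FBondY i × ι => hBdY i (hTY i c) p.1)) * conj b Ds := by
    rw [hRl, B9Eq352DivFormLetters.conj_mul, B9Eq352DivFormLetters.conj_mul, B9Eq352DivFormLetters.conj_mul, conj_cutMulY]
  rw [← hconj]
  have hTc : ∀ (cx : ℂ) (Λ : FBondY i → 𝔸), Rl (cx • Λ) = cx • Rl Λ := fun cx Λ => by
    rw [hRl_apply, hRl_apply, ← cdsBC_apply, ← cdsBC_apply, map_smul, map_smul, map_smul, map_smul]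
  have hC1F : 0 ≤ C1F d ℓ := C1F_nonneg d ℓ
  have hA₀ : 0 ≤ B₀ * (1 + mN * Real.exp δ * (5 / 8 * C1F d ℓ / i.Mh)) := mul_nonneg hB₀ (by positivity)
  have hW0 : ∀ a a' : IBondY i, 0 ≤ (if (∃ y ∈ QT i.D (B9GeoLemma21KLevelV1.one_le_Mh i) (four_le_P' i) c,
        (((bondT i.D).dist (β i.hN i.D i.hk a) y : ℕ) : ℝ) ≤ 2 * (ℓ : ℝ) + 6)
      then (B₀ * (1 + mN * Real.exp δ * (5 / 8 * C1F d ℓ / i.Mh))) * (geo9K i).len a * Real.exp (-(δ * (geo9K i).dist a a'))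
      else 0) := fun a a' =>
    ite_nonneg (mul_nonneg (mul_nonneg hA₀ (B9GeoLemma21KLevelV1.geo9K_len_pos i a).le) (Real.exp_nonneg _)) le_rfl
  refine hasMajorant_mono (g := toB6 (geo9K i) Rr Hp) _
    (hasMajorant_conj_of_ball_boundB i b (Rr := Rr) (Hp := Hp) Rl hTc ιB hι hM₂ hrepr _ hW0 fun J y y' hs E hE1 x hx => ?_)
    fun a a' => le_of_eq ?_
  · rw [hRl_apply]
    by_cases hmem : ∃ yq ∈ QT i.D (B9GeoLemma21KLevelV1.one_le_Mh i) (four_le_P' i) c,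
        (((bondT i.D).dist (β i.hN i.D i.hk y) yq : ℕ) : ℝ) ≤ 2 * (ℓ : ℝ) + 6
    · rw [if_pos hmem]
      exact norm_hOh_cdsB_le i (cfg U₁) (GACubeY i c parS parB (cfg U₁)) c hB₀ hδ hη ιB hι hU
        (h342₀_of_eBlockInvB i b cfg (GACubeY i c parS parB) par hE hM₂ hrepr)
        (h342₂_of_eBlockInvB i b cfg (GACubeY i c parS parB) par hE hM₂ hrepr) T hT hmN hnbr J y y' hs (liftY J E) (norm_liftY_le_abs i J hE1) x μ hx
    · -- the outer cut-off vanishes: `h_□(b₋) ≠ 0` would put `Δ(b) = βy` in `QT □`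
      rw [if_neg hmem, zero_mul]
      refine le_of_eq (norm_eq_zero.2 ?_)
      rw [cutMulY_apply, hBdY_apply]
      by_cases h0 : hTY i c (chartY i x.src) = 0
      · rw [h0, Complex.ofReal_zero, zero_smul]
      · exfalso
        refine hmem ⟨blkOf i.D.toDomains (chartY i x.src), blkOf_mem_QT_of_hT_ne_zero hMh2 hR2 (four_le_P' i) c h0, ?_⟩
        rw [← hx]
        have e : (bondT i.D).dist (blkV1 i.hN i.D x) (blkOf i.D.toDomains (chartY i x.src)) = 0 := SimpleGraph.dist_self
        rw [e, Nat.cast_zero]; positivity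
  · by_cases h : ∃ yq ∈ QT i.D (B9GeoLemma21KLevelV1.one_le_Mh i) (four_le_P' i) c,
        (((bondT i.D).dist (β i.hN i.D i.hk a) yq : ℕ) : ℝ) ≤ 2 * (ℓ : ℝ) + 6
    · rw [if_pos h, if_pos h]; ring
    · rw [if_neg h, if_neg h, mul_zero]

omit [CompleteSpace 𝔸] [NormedAlgebra ℂ 𝔸] in
/-- bookkeeping: a constant `K ≥ 0` localized to FILE 3-B's sets sums over the cubes to at most `N′·K`, `N′ = 3·5^{d+1}e^{αδ(2L+4)}c₁(α)` (`sum_indicator_nearQT_le`).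
[cite: Balaban1984PropagatorsII, p.232 («A summation preserves it also»), Lemma 2.1 (2.61) p.234, p.235] -/
theorem sum_indicator_const_le (hι : ∀ s, β i.hN i.D i.hk (ιB s) = s) (d' : ℕ) {δ α : ℝ} (hαδ : 0 ≤ α * δ)
    (h261 : Ineq261 d' (toB6 (geo9K i) Rr Hp) δ α) (a : IBondY i) {K : ℝ} (hK : 0 ≤ K) :
    (∑ c : ↥(cubes i.D.toDomains),
        (if (∃ y ∈ QT i.D (B9GeoLemma21KLevelV1.one_le_Mh i) (four_le_P' i) c,
            (((bondT i.D).dist (β i.hN i.D i.hk a) y : ℕ) : ℝ) ≤ 2 * (ℓ : ℝ) + 6) then K else 0)) ≤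
      (3 * 5 ^ (d + 1) * (Real.exp (α * δ * (2 * (ℓ : ℝ) + 6)) * B6.c1 d' δ α)) * K := by
  classical
  have hterm : ∀ c : ↥(cubes i.D.toDomains),
      (if (∃ y ∈ QT i.D (B9GeoLemma21KLevelV1.one_le_Mh i) (four_le_P' i) c,
            (((bondT i.D).dist (β i.hN i.D i.hk a) y : ℕ) : ℝ) ≤ 2 * (ℓ : ℝ) + 6) then K else 0) =
      (if (∃ y ∈ QT i.D (B9GeoLemma21KLevelV1.one_le_Mh i) (four_le_P' i) c,
          (((bondT i.D).dist (β i.hN i.D i.hk a) y : ℕ) : ℝ) ≤ 2 * (ℓ : ℝ) + 6) then (1 : ℝ) else 0) * K := by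
    intro c
    by_cases h : ∃ y ∈ QT i.D (B9GeoLemma21KLevelV1.one_le_Mh i) (four_le_P' i) c,
        (((bondT i.D).dist (β i.hN i.D i.hk a) y : ℕ) : ℝ) ≤ 2 * (ℓ : ℝ) + 6
    · rw [if_pos h, if_pos h, one_mul]
    · rw [if_neg h, if_neg h, zero_mul]
  rw [Finset.sum_congr rfl fun c _ => hterm c, ← Finset.sum_mul]
  exact mul_le_mul_of_nonneg_right (sum_indicator_nearQT_le i ιB hι d' hαδ h261 a) hK

omit [CompleteSpace 𝔸] in
/-- ★★ **THE `hKF μ` BOUND OF FILE 2-B AT THE COVER OF RECORD**: the localized majorants of `hasMajorant_conj_divTermB` summed over the cubes: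
`Σ_□ K_{F,□}(a,a′) ≤ N′·M₂(Σ‖b_j‖)·B₀(1 + m_N e^{δ}(5∕8)C1F∕M_h)·ℓ(a)·e^{−δd(a,a′)}` — the `A₂` of FILE 2-B for the backward entries.
[cite: Balaban1985BackgroundPropagators, (3.87) p.409, Thm 3.3 (3.42)₃ p.397; Balaban1984PropagatorsII, p.232, Lemma 2.1 (2.61) p.234, p.235] -/
theorem sum_divTermB_majorant_le (hι : ∀ s, β i.hN i.D i.hk (ιB s) = s) {M₂ : ℝ} (hM₂ : 0 ≤ M₂) {B₀ δ mN : ℝ} (hB₀ : 0 ≤ B₀) (hmN : 0 ≤ mN)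
    (d' : ℕ) {α : ℝ} (hαδ : 0 ≤ α * δ) (h261 : Ineq261 d' (toB6 (geo9K i) Rr Hp) δ α) (a a' : IBondY i) :
    (∑ c : ↥(cubes i.D.toDomains),
        (if (∃ y ∈ QT i.D (B9GeoLemma21KLevelV1.one_le_Mh i) (four_le_P' i) c,
            (((bondT i.D).dist (β i.hN i.D i.hk a) y : ℕ) : ℝ) ≤ 2 * (ℓ : ℝ) + 6)
          then M₂ * (∑ j, ‖b j‖) * (B₀ * (1 + mN * Real.exp δ * (5 / 8 * C1F d ℓ / i.Mh))) * (geo9K i).len a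
            * Real.exp (-(δ * (geo9K i).dist a a')) else 0)) ≤
      (3 * 5 ^ (d + 1) * (Real.exp (α * δ * (2 * (ℓ : ℝ) + 6)) * B6.c1 d' δ α)) *
          (M₂ * (∑ j, ‖b j‖) * (B₀ * (1 + mN * Real.exp δ * (5 / 8 * C1F d ℓ / i.Mh)))) * (geo9K i).len a *
        Real.exp (-(δ * (geo9K i).dist a a')) := by
  have hC1F : 0 ≤ C1F d ℓ := C1F_nonneg d ℓ
  have hSb : 0 ≤ ∑ j, ‖b j‖ := Finset.sum_nonneg fun _ _ => norm_nonneg _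
  have hK0 : 0 ≤ M₂ * (∑ j, ‖b j‖) * (B₀ * (1 + mN * Real.exp δ * (5 / 8 * C1F d ℓ / i.Mh))) * (geo9K i).len a
      * Real.exp (-(δ * (geo9K i).dist a a')) :=
    mul_nonneg (mul_nonneg (mul_nonneg (mul_nonneg hM₂ hSb) (mul_nonneg hB₀ (by positivity)))
      (B9GeoLemma21KLevelV1.geo9K_len_pos i a).le) (Real.exp_nonneg _)
  refine (sum_indicator_const_le i ιB hι d' hαδ h261 a hK0).trans (le_of_eq ?_)
  ring

end Majorant

end Literature.MathematicalPhysics.QuantumFieldTheory.Balaban1983to89.B9Thm310CutoffDivTermsB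

end
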